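/-
Origin: expansion seat `planner-pub-hodgecm-pv06-g3-0`, handover #2 2026-08-18T06:12:11Z (`HOME/pub-hodgecm-pv06-g3/lean/Pv06g3/CompactApproxBridge.lean`, md5 fc54d446, 204 lines);
landed by the gen-6 packager in gate run 24 as `HodgeCM/Automorphic/CompactApproxBridge.lean` (import ^import Prl1g3\.→import HodgeCM.Automorphic. ×1; import ^import Pv[0-9]+g[0-9]+\.→import HodgeCM.PerL34. ×1).
-/
/-
Origin: HOME/pub-hodgecm-pv06-g3/lean/Pv06g3/CompactApproxBridge.lean — session planner-pub-hodgecm-pv06-g3-0 (unit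
pub-hodgecm-pv06-g3, DAG-NODE PROVER #06 of 15, generation 3).  Intended final place: `HodgeCM/Automorphic/CompactApproxBridge.lean`
(namespace `HodgeCM.PerL34.CompactApprox`).  WIP imports: `Pv06g3.CompactApprox` ↦ `HodgeCM.PerL34.CompactApprox` (my HANDOVER #1,
run 24) and `Prl1g3.IntegratedRep` ↦ `HodgeCM.Automorphic.IntegratedRep` (seat prl1-g3, HANDOVER #5, run 24; lands AFTER both).
Closed: nothing cited, nothing posited.

# The compact approximation and the DISCRETE DECOMPOSITION of `L²(G ⧸ Γ)`, by name

`CompactApprox.lean` proved `CompactApproximation (ρHom ν)` — the statement `RepDecomp.HasCompactApprox` with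
`RepDecomp.Invariant` unfolded — for the regular representation on `L²` of a compact quotient `G ⧸ Γ`.  Here, importing
prl1-g3's `RepDecomp` / `RepCoreCarrier` development, the consequences BY NAME:

* `compactApproximation_iff` : `CompactApproximation R ↔ RepDecomp.HasCompactApprox R` (`Iff.rfl`);
* `hasCompactApprox_ρHom` : `RepDecomp.HasCompactApprox (ρHom ν)` — the field `RepCoreCarrier.AnalyticK.compactApprox`
  for the `G`-indexed regular representation, PROVED; `discreteDecomp_ρHom`, `iSup_isotypic_ρHom` — **`L²(G ⧸ Γ)` IS THE
  CLOSED SPAN OF ITS IRREDUCIBLE CLOSED INVARIANT SUBSPACES / of its isotypic components** (Gelfand–Graev–Piatetski-Shapiro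
  for a compact quotient; PerL v5 ll. 384–385 "decomposes discretely"), a theorem of the package with NO cited input;
* `invDma : G →* Gᵈᵐᵃ` (`g ↦ DomMulAct.mk g⁻¹`), `koopman_comp_invDma : (RepDecomp.koopman ν).comp invDma = ρHom ν` — ONE
  operator, two indexings — hence `hasCompactApprox_koopman : RepDecomp.HasCompactApprox (RepDecomp.koopman ν)` and
  `discreteDecomp_koopman_quotient` for prl1-g3's `Gᵈᵐᵃ`-indexed translation representation;
* the carrier-facing corollaries: for a core carrier `C` modelled on `H = Lp ℂ 2 ν` whose `R` IS the regular representation,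
  `analyticK_of_hatτ_complete` (`C.R = ρHom ν`) and `analyticL2_of_hatτ_complete` (`C.R = RepDecomp.koopman ν`) —
  **the analytic hypotheses of the core reduce to `hatτ_complete` ALONE**; unitarity, the compact approximation and the
  discrete decomposition are theorems;
* `…_haar` versions with every instance hypothesis on `ν`, `μ` discharged from a regular Haar measure (`QuotientSmoothingHaar`).
-/
import Summits.HodgeConjecture.HodgeCM.PerL34.CompactApprox
import Summits.HodgeConjecture.HodgeCM.Automorphic.IntegratedRep_2

set_option autoImplicit false

noncomputable section

open MeasureTheory Filter Topology Set
open scoped InnerProductSpace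

namespace HodgeCM
namespace PerL34
namespace CompactApprox

/-! ## §1  The unfolded and the named compact approximation agree -/
section Iff

variable {G : Type*} [Group G]
variable {H : Type*} [NormedAddCommGroup H] [InnerProductSpace ℂ H]

/-- `CompactApproximation R` is `RepDecomp.HasCompactApprox R` (definitional). -/
theorem compactApproximation_iff (R : G →* (H →L[ℂ] H)) :
    CompactApproximation R ↔ RepDecomp.HasCompactApprox R := Iff.rfl

end Iff

/-! ## §2  `L²(G ⧸ Γ)`: compact approximation and discrete decomposition, by name -/
section Model

open QuotientSmoothing

/-- The anti-inversion homomorphism `G →* Gᵈᵐᵃ`, `g ↦ mk g⁻¹`, along which the `G`-indexed regular representation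
`ρHom` is prl1-g3's `Gᵈᵐᵃ`-indexed Koopman representation. -/
def invDma (G : Type*) [Group G] : G →* Gᵈᵐᵃ where
  toFun g := DomMulAct.mk g⁻¹
  map_one' := by rw [inv_one, DomMulAct.mk_one]
  map_mul' a b := by rw [mul_inv_rev, DomMulAct.mk_mul]

/-- (Ported verbatim from the HodgeCMPerL package; no docstring in the source.) -/
@[simp] theorem invDma_apply {G : Type*} [Group G] (g : G) : invDma G g = DomMulAct.mk g⁻¹ := rfl

variable {G : Type*} [Group G] [TopologicalSpace G] [IsTopologicalGroup G] {Γ : Subgroup G}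
variable [MeasurableSpace (G ⧸ Γ)] [BorelSpace (G ⧸ Γ)] (ν : Measure (G ⧸ Γ)) [SMulInvariantMeasure G (G ⧸ Γ) ν]

/-- **One operator, two indexings**: `koopman ν (mk g⁻¹) = ρ ν g`. -/
theorem koopman_invDma (g : G) : RepDecomp.koopman ν (invDma G g) = ρ ν g := by
  refine ContinuousLinearMap.ext fun v => ?_
  rw [RepDecomp.koopman_apply, invDma_apply, Lp.ext_iff]
  filter_upwards [DomMulAct.smul_Lp_ae_eq (DomMulAct.mk g⁻¹) v, coeFn_ρ ν g v] with x h1 h2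
  rw [h1, h2, Equiv.symm_apply_apply]

/-- (Ported verbatim from the HodgeCMPerL package; no docstring in the source.) -/
theorem koopman_comp_invDma : (RepDecomp.koopman ν).comp (invDma G) = ρHom ν :=
  MonoidHom.ext fun g => koopman_invDma ν g

variable [T2Space (G ⧸ Γ)] [IsFiniteMeasure ν] [ν.InnerRegularCompactLTTop] [CompactSpace (G ⧸ Γ)]
variable [MeasurableSpace G] [BorelSpace G] (μ : Measure G) [IsFiniteMeasureOnCompacts μ] [μ.IsOpenPosMeasure]
variable [LocallyCompactSpace G] [DiscreteTopology Γ] [Countable Γ] (hΓ : IsClosed (Γ : Set G))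
  [μ.IsMulLeftInvariant] [μ.IsMulRightInvariant] [μ.IsInvInvariant]
  {𝓕 : Set G} (h𝓕 : IsFundamentalDomain Γ.op 𝓕 μ)
  (hν : ν = Measure.map (QuotientGroup.mk : G → G ⧸ Γ) (μ.restrict 𝓕))

include μ hΓ h𝓕 hν in
/-- **`RepCoreCarrier.AnalyticK.compactApprox` for the regular representation on `L²(G ⧸ Γ)` — PROVED.** -/
theorem hasCompactApprox_ρHom : RepDecomp.HasCompactApprox (ρHom ν) :=
  compactApproximation_ρHom ν μ hΓ h𝓕 hν

include μ hΓ h𝓕 hν in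
/-- **DISCRETE DECOMPOSITION OF `L²(G ⧸ Γ)`, `G ⧸ Γ` COMPACT — PROVED** (Gelfand–Graev–Piatetski-Shapiro; PerL v5
ll. 384–385): `L²(G ⧸ Γ)` is the closed span of its irreducible closed `ρ`-invariant subspaces. -/
theorem discreteDecomp_ρHom :
    (⨆ V : RepDecomp.Irr (ρHom ν), (V.1 : Submodule ℂ (Lp ℂ 2 ν))).topologicalClosure = ⊤ :=
  RepDecomp.discreteDecomp_of_compactApprox (isUnitaryRep_ρHom ν) (hasCompactApprox_ρHom ν μ hΓ h𝓕 hν)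

include μ hΓ h𝓕 hν in
/-- … equivalently, the isotypic components of `L²(G ⧸ Γ)` have dense span. -/
theorem iSup_isotypic_ρHom :
    (⨆ c, RepDecomp.isotypic (ρHom ν) c).topologicalClosure = ⊤ :=
  RepDecomp.iSup_isotypic_complete_of_compactApprox (isUnitaryRep_ρHom ν) (hasCompactApprox_ρHom ν μ hΓ h𝓕 hν)

include μ hΓ h𝓕 hν in
/-- The same compact approximation for prl1-g3's `Gᵈᵐᵃ`-indexed Koopman representation on `L²(G ⧸ Γ)`. -/
theorem hasCompactApprox_koopman : RepDecomp.HasCompactApprox (RepDecomp.koopman ν (M := G)) :=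
  CompactApproximation.of_comp _ (invDma G) (by
    have h := compactApproximation_ρHom ν μ hΓ h𝓕 hν
    rwa [← koopman_comp_invDma ν] at h)

include μ hΓ h𝓕 hν in
/-- Discrete decomposition of `L²(G ⧸ Γ)` under the Koopman representation of `Gᵈᵐᵃ`. -/
theorem discreteDecomp_koopman_quotient :
    (⨆ V : RepDecomp.Irr (RepDecomp.koopman ν (M := G)), (V.1 : Submodule ℂ (Lp ℂ 2 ν))).topologicalClosure = ⊤ :=
  RepDecomp.discreteDecomp_koopman (hasCompactApprox_koopman ν μ hΓ h𝓕 hν)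

end Model

/-! ## §3  The core carrier on `L²(G ⧸ Γ)`: the analytic hypotheses reduce to `hatτ_complete` -/
section Carrier

open QuotientSmoothing

variable {G : Type} [Group G] [TopologicalSpace G] [IsTopologicalGroup G] {Γ : Subgroup G}
variable [MeasurableSpace (G ⧸ Γ)] [BorelSpace (G ⧸ Γ)] (ν : Measure (G ⧸ Γ)) [SMulInvariantMeasure G (G ⧸ Γ) ν]
variable [T2Space (G ⧸ Γ)] [IsFiniteMeasure ν] [ν.InnerRegularCompactLTTop] [CompactSpace (G ⧸ Γ)]
variable [MeasurableSpace G] [BorelSpace G] (μ : Measure G) [IsFiniteMeasureOnCompacts μ] [μ.IsOpenPosMeasure]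
variable [LocallyCompactSpace G] [DiscreteTopology Γ] [Countable Γ] (hΓ : IsClosed (Γ : Set G))
  [μ.IsMulLeftInvariant] [μ.IsMulRightInvariant] [μ.IsInvInvariant]
  {𝓕 : Set G} (h𝓕 : IsFundamentalDomain Γ.op 𝓕 μ)
  (hν : ν = Measure.map (QuotientGroup.mk : G → G ⧸ Γ) (μ.restrict 𝓕))
variable {HG CG SK SigIdxG : Type}
variable [NormedAddCommGroup HG] [InnerProductSpace ℂ HG] [CompleteSpace HG]
variable [NormedAddCommGroup CG] [NormedSpace ℂ CG] [TopologicalSpace SK]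

include μ hΓ h𝓕 hν in
/-- **A core carrier ON `L²(G ⧸ Γ)` whose `R` IS the regular representation `ρHom ν` satisfies `AnalyticK` as soon as
`hatτ_complete` holds**: `R_unitary` (`isUnitaryRep_ρHom`) and `compactApprox` (`hasCompactApprox_ρHom`) are theorems. -/
theorem analyticK_of_hatτ_complete (C : RepCoreCarrier (Lp ℂ 2 ν) HG CG G SK SigIdxG) (hR : C.R = ρHom ν)
    (hτ : (⨆ j, C.hatτ j).topologicalClosure = ⊤) : C.AnalyticK where
  R_unitary := by
    rw [hR]
    exact isUnitaryRep_ρHom ν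
  compactApprox := by
    rw [hR]
    exact hasCompactApprox_ρHom ν μ hΓ h𝓕 hν
  hatτ_complete := hτ

include μ hΓ h𝓕 hν in
/-- The same for prl1-g3's `Gᵈᵐᵃ`-indexed model: `AnalyticL2` from `R_eq` and `hatτ_complete` alone. -/
theorem analyticL2_of_hatτ_complete (C : RepCoreCarrier (Lp ℂ 2 ν) HG CG Gᵈᵐᵃ SK SigIdxG)
    (hR : C.R = RepDecomp.koopman ν) (hτ : (⨆ j, C.hatτ j).topologicalClosure = ⊤) : C.AnalyticL2 where
  R_eq := hR
  compactApprox := by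
    rw [hR]
    exact hasCompactApprox_koopman ν μ hΓ h𝓕 hν
  hatτ_complete := hτ

end Carrier

/-! ## §4  Haar measure: the instance hypotheses discharged -/
section Haar

open QuotientSmoothing

attribute [-instance] Quotient.instMeasurableSpace

variable {G : Type*} [Group G] [TopologicalSpace G] [IsTopologicalGroup G] [LocallyCompactSpace G]
  [MeasurableSpace G] [BorelSpace G] {Γ : Subgroup G} [DiscreteTopology Γ] [Countable Γ]
  (hΓ : IsClosed (Γ : Set G))
  [MeasurableSpace (G ⧸ Γ)] [BorelSpace (G ⧸ Γ)] [CompactSpace (G ⧸ Γ)]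
  (μ : Measure G) [Measure.IsHaarMeasure μ] [μ.Regular] [μ.IsMulRightInvariant]
  {𝓕 : Set G} (h𝓕 : IsFundamentalDomain Γ.op 𝓕 μ)

include hΓ h𝓕 in
/-- **`HasCompactApprox` of the regular representation of `L²(G ⧸ Γ, map π (μ|𝓕))` for a regular Haar measure `μ` on
the unimodular `G`** — hypotheses = the data of the model. -/
theorem hasCompactApprox_haar :
    haveI := hΓ
    haveI := smulInvariantMeasure_map_restrict μ h𝓕
    RepDecomp.HasCompactApprox (ρHom (Measure.map (QuotientGroup.mk : G → G ⧸ Γ) (μ.restrict 𝓕))) :=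
  compactApproximation_haar hΓ μ h𝓕

include hΓ h𝓕 in
/-- **Discrete decomposition of `L²(G ⧸ Γ)` for Haar measure** — hypotheses = the data of the model. -/
theorem discreteDecomp_haar :
    haveI := hΓ
    haveI := smulInvariantMeasure_map_restrict μ h𝓕
    (⨆ V : RepDecomp.Irr (ρHom (Measure.map (QuotientGroup.mk : G → G ⧸ Γ) (μ.restrict 𝓕))),
      (V.1 : Submodule ℂ (Lp ℂ 2 (Measure.map (QuotientGroup.mk : G → G ⧸ Γ) (μ.restrict 𝓕))))).topologicalClosure
      = ⊤ := by
  haveI := hΓ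
  haveI := smulInvariantMeasure_map_restrict μ h𝓕
  exact RepDecomp.discreteDecomp_of_compactApprox (isUnitaryRep_ρHom _) (hasCompactApprox_haar hΓ μ h𝓕)

end Haar

end CompactApprox
end PerL34
end HodgeCM

end
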